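import Mathlib
import Summits.CriticalPhenomena.Ising3DConformalLimit.Theorems.PrecisionLaplacianMoebiusLimitOfTwoPointLawInversionBegetsRotations
import Literature.Probability.LatticeModels.ConformalCovariance
import HarnessLib

/-!
# Translations and the unit inversion beget EVERY dilation: `inversionBegetsDilations`
# (crux `MoebiusLimitOfTwoPointLaw`, item stmt-CriticalPhenomena-4801; line `SketchIdeator5R2` =
# card `inversion-buys-the-filter`, Lemma B; `--supports stmt-CriticalPhenomena-4801`)

For every weight `Δ : ℝ` and every correlation family `S : CorrFamily 3` on `ℝ³`, translation
invariance and covariance under the unit inversion `ι y = y/‖y‖²` with weight `Δ`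
(`IsInversionCovariant Δ S`, configurations off the origin) imply scale covariance with the SAME
`Δ` (`IsScaleCovariant Δ S`), with no continuity and no normalisation. This is the dilation half of
"translations + `ι` generate the Möbius group of `ℝ³ ∪ {∞}`"; the rotation half is the landed item
stmt-CriticalPhenomena-4675 (`stub_inversionBegetsRotations`, imported for `inversion_zero_one_eq_smul`).

Proof. Fix a unit vector `a` and `τ ≠ 0`, put `m = 1 + τ²`. The Möbius word
`ι ∘ τ_{−(τ/m)a} ∘ ι ∘ τ_{τa} ∘ ι ∘ τ_{τa} ∘ ι ∘ τ_{−(τ/m)a}` is the dilation `y ↦ m² y`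
(`inversion_z4`): with `Q = ‖y‖²`, `N₁ = ‖y − (τ/m)a‖²`, `M₁ = ‖τ y + a/m‖²` the four points met
on the way are `z₁ = y − (τ/m)a`, `z₂ = N₁⁻¹(y + R a)` (`R = τ(N₁ − 1/m)`),
`z₃ = M₁⁻¹(y + τ m Q a)`, `z₄ = y/(m²Q)`, and their squared norms `N₁`, `M₁/N₁`, `m²Q/M₁`,
`1/(m⁴Q)` multiply to `m⁻²`, so the four inversion weights multiply to the dilation weight
(`weight_prod`, `apply_dilation_of_ne`). The three poles (`y = 0`, `N₁ = 0`, `M₁ = 0`) are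
avoided by a generic translation of the configuration (`apply_dilation`), exactly as in the
landed rotation half. Every `c > 1` is `m²` for `τ = √(√c − 1)` (`scale_of_one_lt`); `c < 1`
follows at the configuration `c • x` (`inversionBegetsDilations`).

The intermediate scalars and points are LOCAL NOTATIONS (`mOf(τ)`, `N1(a, y, τ)`, …), not
definitions: this file declares theorems only. References: crux workfile
`Cruxes/MoebiusLimitOfTwoPointLaw/SketchIdeator5R2.lean` (ideator's sketch, same word); Di Francesco–
Mathieu–Sénéchal, *Conformal Field Theory* (1997) §4.1 (`ι ∘ τ_b ∘ ι`; `P_μ, K_μ` generate dilations);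
Benedetti–Petronio (1992) ch. A. Nothing here is specific to the Ising model. [folklore]
-/

noncomputable section

namespace Summit.CriticalPhenomena.Ising3DConformalLimit.PrecisionLaplacianMoebiusLimitOfTwoPointLaw

open Literature.Probability.LatticeModels EuclideanGeometry

/-! ### Scalar bookkeeping -/

/-- `‖y + c • a‖² = ‖y‖² + 2c⟪y,a⟫ + c²` for a unit vector `a`. [folklore] -/
theorem normsq_add_smul_unit {a : EuclideanSpace ℝ (Fin 3)} (ha : ‖a‖ = 1)
    (y : EuclideanSpace ℝ (Fin 3)) (c : ℝ) :
    ‖y + c • a‖ ^ 2 = ‖y‖ ^ 2 + 2 * c * inner ℝ y a + c ^ 2 := by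
  rw [norm_add_sq_real, norm_smul, real_inner_smul_right, ha, mul_one, Real.norm_eq_abs, sq_abs]
  ring

/-- Unit inversion of a nonzero scalar multiple: `ι (c • v) = (c ‖v‖²)⁻¹ • v` (`c ≠ 0`; both sides
vanish at `v = 0`). [folklore] -/
theorem inversion_smul_eq {c : ℝ} (hc : c ≠ 0) (v : EuclideanSpace ℝ (Fin 3)) :
    inversion 0 1 (c • v) = (c * ‖v‖ ^ 2)⁻¹ • v := by
  rw [inversion_zero_one_eq_smul, norm_smul, mul_pow, Real.norm_eq_abs, sq_abs, smul_smul]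
  by_cases hv : v = 0
  · simp [hv]
  · have hv2 : ‖v‖ ^ 2 ≠ 0 := by positivity
    congr 1
    field_simp

/-! ### The scalars and the four points of the word (local notations) -/

/-- `m = 1 + τ²`. -/
local notation "mOf(" τ ")" => ((1 : ℝ) + τ ^ 2)

/-- `N₁ = ‖y − (τ/m) a‖² = ‖y‖² − 2(τ/m)⟪y,a⟫ + (τ/m)²`. -/
local notation "N1(" a ", " y ", " τ ")" =>
  (‖y‖ ^ 2 + 2 * (-(τ / mOf(τ))) * inner ℝ y a + (-(τ / mOf(τ))) ^ 2)

/-- `R = τ (N₁ − 1/m)`. -/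
local notation "R1(" a ", " y ", " τ ")" => (τ * (N1(a, y, τ) - 1 / mOf(τ)))

/-- `M₁ = m⁻² + 2(τ/m)⟪y,a⟫ + τ²‖y‖²` (`= ‖τ y + m⁻¹ a‖²`). -/
local notation "M1(" a ", " y ", " τ ")" =>
  ((mOf(τ) ^ 2)⁻¹ + 2 * (τ / mOf(τ)) * inner ℝ y a + τ ^ 2 * ‖y‖ ^ 2)

/-- `z₁ = y − (τ/m) a`. -/
local notation "z1(" a ", " y ", " τ ")" => (y + (-(τ / mOf(τ))) • a)
/-- `z₂ = ι z₁ + τ a`. -/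
local notation "z2(" a ", " y ", " τ ")" => (inversion 0 1 (z1(a, y, τ)) + τ • a)
/-- `z₃ = ι z₂ + τ a`. -/
local notation "z3(" a ", " y ", " τ ")" => (inversion 0 1 (z2(a, y, τ)) + τ • a)
/-- `z₄ = ι z₃ − (τ/m) a`. -/
local notation "z4(" a ", " y ", " τ ")" =>
  (inversion 0 1 (z3(a, y, τ)) + (-(τ / mOf(τ))) • a)

/-- `0 < m = 1 + τ²`. [folklore] -/
theorem mOf_pos (τ : ℝ) : 0 < mOf(τ) := by positivity
/-- `m = 1 + τ² ≠ 0`. [folklore] -/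
theorem mOf_ne (τ : ℝ) : mOf(τ) ≠ 0 := (mOf_pos τ).ne'

/-- `‖z₁‖² = N₁`. [folklore] -/
theorem normsq_z1 {a : EuclideanSpace ℝ (Fin 3)} (ha : ‖a‖ = 1) (y : EuclideanSpace ℝ (Fin 3))
    (τ : ℝ) : ‖z1(a, y, τ)‖ ^ 2 = N1(a, y, τ) :=
  normsq_add_smul_unit ha y _

/-- The key factorisation of step 2: `‖y + R a‖² = N₁ · M₁`. [folklore] -/
theorem normsq_step2 {a : EuclideanSpace ℝ (Fin 3)} (ha : ‖a‖ = 1) (y : EuclideanSpace ℝ (Fin 3))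
    (τ : ℝ) : ‖y + R1(a, y, τ) • a‖ ^ 2 = N1(a, y, τ) * M1(a, y, τ) := by
  rw [normsq_add_smul_unit ha]
  have hm0 : mOf(τ) ≠ 0 := mOf_ne τ
  field_simp
  ring

/-- Step 3 scalar: `R + τ M₁ = τ m ‖y‖²`. [folklore] -/
theorem R1_add (a y : EuclideanSpace ℝ (Fin 3)) (τ : ℝ) :
    R1(a, y, τ) + τ * M1(a, y, τ) = τ * mOf(τ) * ‖y‖ ^ 2 := by
  have hm0 : mOf(τ) ≠ 0 := mOf_ne τ
  field_simp
  ring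

/-- Step 3 norm: `‖y + (τ m Q) a‖² = m² Q M₁`, `Q = ‖y‖²`. [folklore] -/
theorem normsq_step3 {a : EuclideanSpace ℝ (Fin 3)} (ha : ‖a‖ = 1) (y : EuclideanSpace ℝ (Fin 3))
    (τ : ℝ) :
    ‖y + (τ * mOf(τ) * ‖y‖ ^ 2) • a‖ ^ 2 = mOf(τ) ^ 2 * ‖y‖ ^ 2 * M1(a, y, τ) := by
  rw [normsq_add_smul_unit ha]
  have hm0 : mOf(τ) ≠ 0 := mOf_ne τ
  field_simp

/-- `M₁ = ‖τ y + m⁻¹ a‖²` (so `M₁ = 0` only at the pole `y = −a/(τ m)`). [folklore] -/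
theorem M1_eq_normsq {a : EuclideanSpace ℝ (Fin 3)} (ha : ‖a‖ = 1) (y : EuclideanSpace ℝ (Fin 3))
    (τ : ℝ) : M1(a, y, τ) = ‖τ • y + (mOf(τ))⁻¹ • a‖ ^ 2 := by
  rw [norm_add_sq_real, norm_smul, norm_smul, real_inner_smul_left, real_inner_smul_right, ha,
    mul_one, Real.norm_eq_abs, Real.norm_eq_abs, mul_pow, sq_abs, sq_abs]
  have hm0 : mOf(τ) ≠ 0 := mOf_ne τ
  field_simp
  ring

/-! ### The four steps of the word -/

section Steps

variable {a : EuclideanSpace ℝ (Fin 3)} (ha : ‖a‖ = 1) {y : EuclideanSpace ℝ (Fin 3)} {τ : ℝ}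
  (hy : y ≠ 0) (hN : N1(a, y, τ) ≠ 0) (hM : M1(a, y, τ) ≠ 0)
include ha

include hN in
/-- `z₂ = N₁⁻¹ • (y + R a)` (since `ι z₁ = N₁⁻¹ • z₁`). [folklore] -/
theorem z2_eq : z2(a, y, τ) = (N1(a, y, τ))⁻¹ • (y + R1(a, y, τ) • a) := by
  have h1 : inversion 0 1 (z1(a, y, τ)) = (N1(a, y, τ))⁻¹ • z1(a, y, τ) := by
    rw [inversion_zero_one_eq_smul, normsq_z1 ha]
  rw [h1]
  have hm0 : mOf(τ) ≠ 0 := mOf_ne τ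
  have hNi : (N1(a, y, τ))⁻¹ * N1(a, y, τ) = 1 := inv_mul_cancel₀ hN
  have hs : (N1(a, y, τ))⁻¹ * (-(τ / mOf(τ))) + τ = (N1(a, y, τ))⁻¹ * R1(a, y, τ) := by
    linear_combination (-τ) * hNi
  calc (N1(a, y, τ))⁻¹ • z1(a, y, τ) + τ • a
        = (N1(a, y, τ))⁻¹ • y + ((N1(a, y, τ))⁻¹ * (-(τ / mOf(τ))) + τ) • a := by module
    _ = (N1(a, y, τ))⁻¹ • y + ((N1(a, y, τ))⁻¹ * R1(a, y, τ)) • a := by rw [hs]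
    _ = (N1(a, y, τ))⁻¹ • (y + R1(a, y, τ) • a) := by module

include hN in
/-- `‖z₂‖² = M₁ / N₁`. [folklore] -/
theorem normsq_z2 : ‖z2(a, y, τ)‖ ^ 2 = M1(a, y, τ) / N1(a, y, τ) := by
  rw [z2_eq ha hN, norm_smul, mul_pow, Real.norm_eq_abs, sq_abs, normsq_step2 ha]
  field_simp

include hN hM in
/-- `z₃ = M₁⁻¹ • (y + τ m ‖y‖² a)` (since `ι z₂ = M₁⁻¹ • (y + R a)` and `R + τ M₁ = τ m ‖y‖²`).
[folklore] -/
theorem z3_eq : z3(a, y, τ) = (M1(a, y, τ))⁻¹ • (y + (τ * mOf(τ) * ‖y‖ ^ 2) • a) := by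
  have h1 : inversion 0 1 (z2(a, y, τ)) = (M1(a, y, τ))⁻¹ • (y + R1(a, y, τ) • a) := by
    rw [z2_eq ha hN, inversion_smul_eq (inv_ne_zero hN), normsq_step2 ha,
      inv_mul_cancel_left₀ hN]
  rw [h1]
  have hm0 : mOf(τ) ≠ 0 := mOf_ne τ
  have hMi : (M1(a, y, τ))⁻¹ * M1(a, y, τ) = 1 := inv_mul_cancel₀ hM
  have hs : (M1(a, y, τ))⁻¹ * R1(a, y, τ) + τ = (M1(a, y, τ))⁻¹ * (τ * mOf(τ) * ‖y‖ ^ 2) := by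
    linear_combination (M1(a, y, τ))⁻¹ * R1_add a y τ + (-τ) * hMi
  calc (M1(a, y, τ))⁻¹ • (y + R1(a, y, τ) • a) + τ • a
        = (M1(a, y, τ))⁻¹ • y + ((M1(a, y, τ))⁻¹ * R1(a, y, τ) + τ) • a := by module
    _ = (M1(a, y, τ))⁻¹ • y + ((M1(a, y, τ))⁻¹ * (τ * mOf(τ) * ‖y‖ ^ 2)) • a := by rw [hs]
    _ = (M1(a, y, τ))⁻¹ • (y + (τ * mOf(τ) * ‖y‖ ^ 2) • a) := by module

include hN hM in
/-- `‖z₃‖² = m² ‖y‖² / M₁`. [folklore] -/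
theorem normsq_z3 : ‖z3(a, y, τ)‖ ^ 2 = mOf(τ) ^ 2 * ‖y‖ ^ 2 / M1(a, y, τ) := by
  rw [z3_eq ha hN hM, norm_smul, mul_pow, Real.norm_eq_abs, sq_abs, normsq_step3 ha]
  field_simp

include hy hN hM in
/-- `z₄ = (m² ‖y‖²)⁻¹ • y` (since `ι z₃ = (m² ‖y‖²)⁻¹ • (y + τ m ‖y‖² a)`). [folklore] -/
theorem z4_eq : z4(a, y, τ) = (mOf(τ) ^ 2 * ‖y‖ ^ 2)⁻¹ • y := by
  have hQ : ‖y‖ ^ 2 ≠ 0 := by positivity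
  have hm0 : mOf(τ) ≠ 0 := mOf_ne τ
  have h1 : inversion 0 1 (z3(a, y, τ))
      = (mOf(τ) ^ 2 * ‖y‖ ^ 2)⁻¹ • (y + (τ * mOf(τ) * ‖y‖ ^ 2) • a) := by
    rw [z3_eq ha hN hM, inversion_smul_eq (inv_ne_zero hM), normsq_step3 ha,
      mul_comm (mOf(τ) ^ 2 * ‖y‖ ^ 2) (M1(a, y, τ)), inv_mul_cancel_left₀ hM]
  rw [h1]
  have hs : (mOf(τ) ^ 2 * ‖y‖ ^ 2)⁻¹ * (τ * mOf(τ) * ‖y‖ ^ 2) + (-(τ / mOf(τ))) = 0 := by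
    field_simp
    ring
  calc (mOf(τ) ^ 2 * ‖y‖ ^ 2)⁻¹ • (y + (τ * mOf(τ) * ‖y‖ ^ 2) • a) + (-(τ / mOf(τ))) • a
        = (mOf(τ) ^ 2 * ‖y‖ ^ 2)⁻¹ • y
          + ((mOf(τ) ^ 2 * ‖y‖ ^ 2)⁻¹ * (τ * mOf(τ) * ‖y‖ ^ 2) + (-(τ / mOf(τ)))) • a := by module
    _ = (mOf(τ) ^ 2 * ‖y‖ ^ 2)⁻¹ • y := by rw [hs, zero_smul, add_zero]

include hy hN hM in
/-- `‖z₄‖² = (m⁴ ‖y‖²)⁻¹`. [folklore] -/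
theorem normsq_z4 : ‖z4(a, y, τ)‖ ^ 2 = (mOf(τ) ^ 4 * ‖y‖ ^ 2)⁻¹ := by
  have hQ : ‖y‖ ^ 2 ≠ 0 := by positivity
  have hm0 : mOf(τ) ≠ 0 := mOf_ne τ
  rw [z4_eq ha hy hN hM, norm_smul, mul_pow, Real.norm_eq_abs, sq_abs]
  field_simp

include hy hN hM in
/-- **The word is the dilation by `m²`**: `ι z₄ = m² • y`. [folklore] -/
theorem inversion_z4 : inversion 0 1 (z4(a, y, τ)) = (mOf(τ) ^ 2) • y := by
  have hQ : ‖y‖ ^ 2 ≠ 0 := by positivity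
  have hm0 : mOf(τ) ≠ 0 := mOf_ne τ
  rw [z4_eq ha hy hN hM, inversion_smul_eq (by positivity)]
  congr 1
  field_simp

include hy hN hM in
/-- **The four weights multiply to the dilation weight**: `‖z₁‖‖z₂‖‖z₃‖‖z₄‖ = m⁻¹`.
[folklore] -/
theorem weight_prod :
    ‖z1(a, y, τ)‖ * ‖z2(a, y, τ)‖ * ‖z3(a, y, τ)‖ * ‖z4(a, y, τ)‖ = (mOf(τ))⁻¹ := by
  have hQ : ‖y‖ ^ 2 ≠ 0 := by positivity
  have hm : 0 < mOf(τ) := mOf_pos τ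
  have h : (‖z1(a, y, τ)‖ * ‖z2(a, y, τ)‖ * ‖z3(a, y, τ)‖ * ‖z4(a, y, τ)‖) ^ 2
      = ((mOf(τ))⁻¹) ^ 2 := by
    rw [mul_pow, mul_pow, mul_pow, normsq_z1 ha, normsq_z2 ha hN, normsq_z3 ha hN hM,
      normsq_z4 ha hy hN hM]
    have e : N1(a, y, τ) * (M1(a, y, τ) / N1(a, y, τ)) * (mOf(τ) ^ 2 * ‖y‖ ^ 2 / M1(a, y, τ))
          * (mOf(τ) ^ 4 * ‖y‖ ^ 2)⁻¹
        = (N1(a, y, τ) * (N1(a, y, τ))⁻¹) * (M1(a, y, τ) * (M1(a, y, τ))⁻¹)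
          * ((mOf(τ) ^ 2 * ‖y‖ ^ 2) * (mOf(τ) ^ 4 * ‖y‖ ^ 2)⁻¹) := by ring
    rw [e, mul_inv_cancel₀ hN, mul_inv_cancel₀ hM, one_mul, one_mul]
    field_simp
  exact (pow_left_inj₀ (by positivity) (by positivity) two_ne_zero).1 h

end Steps

/-! ### Correlation families: the word covariance, pole avoidance, and the dilations -/

section Covariance

variable {S : CorrFamily 3} {Δ : ℝ}

/-- At a configuration avoiding the three poles (`xᵢ ≠ 0`, `N₁ ≠ 0`, `M₁ ≠ 0` pointwise), a
translation-invariant, inversion-covariant family transforms under the dilation by `m²` with the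
product of the four inversion weights, i.e. with `∏ (m⁻¹)^{2Δ}`: four uses of inversion
covariance, four of translation invariance. [folklore] -/
theorem apply_dilation_of_ne (htr : IsTranslationInvariant S) (hinv : IsInversionCovariant Δ S)
    {a : EuclideanSpace ℝ (Fin 3)} (ha : ‖a‖ = 1) (τ : ℝ) {n : ℕ}
    (x : Fin n → EuclideanSpace ℝ (Fin 3))
    (hx0 : ∀ i, x i ≠ 0) (hxN : ∀ i, N1(a, x i, τ) ≠ 0) (hxM : ∀ i, M1(a, x i, τ) ≠ 0) :
    S n (fun i => (mOf(τ) ^ 2) • x i) = (∏ _i : Fin n, ((mOf(τ))⁻¹) ^ (2 * Δ)) * S n x := by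
  have key : ∀ i, ‖z1(a, x i, τ)‖ * ‖z2(a, x i, τ)‖ * ‖z3(a, x i, τ)‖ * ‖z4(a, x i, τ)‖
      = (mOf(τ))⁻¹ :=
    fun i => weight_prod ha (hx0 i) (hxN i) (hxM i)
  have hm : (mOf(τ))⁻¹ ≠ 0 := inv_ne_zero (mOf_ne τ)
  have h1 : ∀ i, z1(a, x i, τ) ≠ 0 := fun i h => by
    have h' := key i; rw [h, norm_zero, zero_mul, zero_mul, zero_mul] at h'; exact hm h'.symm
  have h2 : ∀ i, z2(a, x i, τ) ≠ 0 := fun i h => by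
    have h' := key i; rw [h, norm_zero, mul_zero, zero_mul, zero_mul] at h'; exact hm h'.symm
  have h3 : ∀ i, z3(a, x i, τ) ≠ 0 := fun i h => by
    have h' := key i; rw [h, norm_zero, mul_zero, zero_mul] at h'; exact hm h'.symm
  have h4 : ∀ i, z4(a, x i, τ) ≠ 0 := fun i h => by
    have h' := key i; rw [h, norm_zero, mul_zero] at h'; exact hm h'.symm
  have hcfg : (fun i => (mOf(τ) ^ 2) • x i) = fun i => inversion 0 1 (z4(a, x i, τ)) :=
    funext fun i => (inversion_z4 ha (hx0 i) (hxN i) (hxM i)).symm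
  have t4 := htr n ((-(τ / mOf(τ))) • a) (fun i => inversion 0 1 (z3(a, x i, τ)))
  have t3 := htr n (τ • a) (fun i => inversion 0 1 (z2(a, x i, τ)))
  have t2 := htr n (τ • a) (fun i => inversion 0 1 (z1(a, x i, τ)))
  have t1 : S n (fun i => z1(a, x i, τ)) = S n x := htr n ((-(τ / mOf(τ))) • a) x
  rw [hcfg, hinv n _ h4, t4, hinv n _ h3, t3, hinv n _ h2, t2, hinv n _ h1, t1,
    ← mul_assoc, ← mul_assoc, ← mul_assoc]
  congr 1
  rw [← Finset.prod_mul_distrib, ← Finset.prod_mul_distrib, ← Finset.prod_mul_distrib]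
  refine Finset.prod_congr rfl fun i _ => ?_
  rw [← Real.mul_rpow (norm_nonneg _) (norm_nonneg _),
    ← Real.mul_rpow (mul_nonneg (norm_nonneg _) (norm_nonneg _)) (norm_nonneg _),
    ← Real.mul_rpow (mul_nonneg (mul_nonneg (norm_nonneg _) (norm_nonneg _)) (norm_nonneg _))
      (norm_nonneg _)]
  congr 1
  rw [← key i]
  ring

/-- Pole avoidance by a generic translation: the word covariance at EVERY configuration
(`τ ≠ 0`). [folklore] -/
theorem apply_dilation (htr : IsTranslationInvariant S) (hinv : IsInversionCovariant Δ S)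
    {a : EuclideanSpace ℝ (Fin 3)} (ha : ‖a‖ = 1) {τ : ℝ} (hτ : τ ≠ 0) {n : ℕ}
    (x : Fin n → EuclideanSpace ℝ (Fin 3)) :
    S n (fun i => (mOf(τ) ^ 2) • x i) = (∏ _i : Fin n, ((mOf(τ))⁻¹) ^ (2 * Δ)) * S n x := by
  have ha0 : a ≠ 0 := by rw [← norm_ne_zero_iff, ha]; exact one_ne_zero
  haveI : Infinite (EuclideanSpace ℝ (Fin 3)) :=
    Infinite.of_injective (fun c : ℝ => c • a) (smul_left_injective ℝ ha0)
  set p₁ : EuclideanSpace ℝ (Fin 3) := (τ / mOf(τ)) • a with hp₁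
  set p₂ : EuclideanSpace ℝ (Fin 3) := (-(τ⁻¹ * (mOf(τ))⁻¹)) • a with hp₂
  obtain ⟨u, hu⟩ := Infinite.exists_notMem_finset
    (Finset.univ.image (fun i => -x i) ∪ Finset.univ.image (fun i => p₁ - x i) ∪
      Finset.univ.image (fun i => p₂ - x i))
  simp only [Finset.mem_union, Finset.mem_image, Finset.mem_univ, true_and, not_or,
    not_exists] at hu
  obtain ⟨⟨hu0, hu1⟩, hu2⟩ := hu
  have hy0 : ∀ i, x i + u ≠ 0 := fun i h => hu0 i (add_eq_zero_iff_neg_eq.1 h)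
  have hy1 : ∀ i, x i + u ≠ p₁ := fun i h =>
    hu1 i (sub_eq_iff_eq_add.2 (h.symm.trans (add_comm _ _)))
  have hy2 : ∀ i, x i + u ≠ p₂ := fun i h =>
    hu2 i (sub_eq_iff_eq_add.2 (h.symm.trans (add_comm _ _)))
  have hN : ∀ i, N1(a, x i + u, τ) ≠ 0 := by
    intro i hN0
    have hz : z1(a, x i + u, τ) = 0 := by
      have h := normsq_z1 ha (x i + u) τ
      rw [hN0] at h
      exact norm_eq_zero.1 (pow_eq_zero_iff two_ne_zero |>.1 h)
    apply hy1 i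
    rw [hp₁]
    rw [neg_smul, ← sub_eq_add_neg, sub_eq_zero] at hz
    exact hz
  have hM : ∀ i, M1(a, x i + u, τ) ≠ 0 := by
    intro i hM0
    rw [M1_eq_normsq ha] at hM0
    have hz : τ • (x i + u) + (mOf(τ))⁻¹ • a = 0 :=
      norm_eq_zero.1 (pow_eq_zero_iff two_ne_zero |>.1 hM0)
    apply hy2 i
    rw [hp₂]
    have h' : τ • (x i + u) = -((mOf(τ))⁻¹ • a) := eq_neg_of_add_eq_zero_left hz
    have h'' : x i + u = τ⁻¹ • (τ • (x i + u)) := by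
      rw [smul_smul, inv_mul_cancel₀ hτ, one_smul]
    rw [h'', h', smul_neg, smul_smul, neg_smul]
  have key := apply_dilation_of_ne htr hinv ha τ (fun i => x i + u) hy0 hN hM
  rw [htr n u x] at key
  have hcfg : (fun i => (mOf(τ) ^ 2) • (x i + u))
      = fun i => (mOf(τ) ^ 2) • x i + (mOf(τ) ^ 2) • u :=
    funext fun i => smul_add _ _ _
  rw [hcfg, htr n _ (fun i => (mOf(τ) ^ 2) • x i)] at key
  exact key

/-- The product of weights is the dilation weight: `∏ (m⁻¹)^{2Δ} = (m²)^{-nΔ}`. [folklore] -/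
theorem prod_weight_eq (τ : ℝ) (n : ℕ) (Δ : ℝ) :
    (∏ _i : Fin n, ((mOf(τ))⁻¹) ^ (2 * Δ)) = (mOf(τ) ^ 2) ^ (-(n : ℝ) * Δ) := by
  have hm : 0 < mOf(τ) := mOf_pos τ
  rw [Finset.prod_const, Finset.card_univ, Fintype.card_fin, ← Real.rpow_mul_natCast (by positivity),
    Real.inv_rpow hm.le, ← Real.rpow_neg hm.le]
  have h2 : (mOf(τ) ^ 2 : ℝ) = mOf(τ) ^ (2 : ℝ) := by norm_cast
  rw [h2, ← Real.rpow_mul hm.le]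
  congr 1
  ring

/-- Scale covariance for every factor `c > 1` (`c = m²` with `m = 1 + τ²`, `τ = √(√c − 1) ≠ 0`).
[folklore] -/
theorem scale_of_one_lt (htr : IsTranslationInvariant S) (hinv : IsInversionCovariant Δ S)
    {c : ℝ} (hc : 1 < c) (n : ℕ) (x : Fin n → EuclideanSpace ℝ (Fin 3)) :
    S n (fun i => c • x i) = c ^ (-(n : ℝ) * Δ) * S n x := by
  set τ : ℝ := Real.sqrt (Real.sqrt c - 1) with hτ
  have hsc : 1 < Real.sqrt c := by
    rw [show (1:ℝ) = Real.sqrt 1 by simp]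
    exact Real.sqrt_lt_sqrt zero_le_one hc
  have hτpos : 0 < τ := Real.sqrt_pos.2 (by linarith)
  have hm : mOf(τ) = Real.sqrt c := by
    rw [hτ, Real.sq_sqrt (by linarith)]
    ring
  have hm2 : mOf(τ) ^ 2 = c := by
    rw [hm, Real.sq_sqrt (by linarith)]
  -- a unit vector
  obtain ⟨a, ha⟩ := exists_norm_eq (EuclideanSpace ℝ (Fin 3)) zero_le_one
  have key := apply_dilation htr hinv ha hτpos.ne' x
  rw [prod_weight_eq, hm2] at key
  exact key

end Covariance

/-- **Lemma B: translations and the unit inversion beget every dilation.** For every `Δ : ℝ`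
and every `S : CorrFamily 3`,
`IsTranslationInvariant S → IsInversionCovariant Δ S → IsScaleCovariant Δ S` — no continuity,
no normalisation, the same weight `Δ`. Together with item 4675 (`stub_inversionBegetsRotations`,
the rotations) this says: translations + `ι` generate the whole Möbius group of `ℝ³ ∪ {∞}` at
the level of covariant correlation families. [folklore] -/
theorem inversionBegetsDilations :
    ∀ (Δ : ℝ) (S : CorrFamily 3), IsTranslationInvariant S → IsInversionCovariant Δ S →
      IsScaleCovariant Δ S := by
  intro Δ S htr hinv n c hc x
  rcases lt_trichotomy c 1 with hlt | heq | hgt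
  · -- `c < 1`: apply the case `c⁻¹ > 1` at the configuration `c • x`
    have hinv1 : 1 < c⁻¹ := (one_lt_inv₀ hc).2 hlt
    have key := scale_of_one_lt htr hinv hinv1 n (fun i => c • x i)
    have hcfg : (fun i => c⁻¹ • (c • x i)) = x := by
      funext i
      rw [smul_smul, inv_mul_cancel₀ hc.ne', one_smul]
    rw [hcfg, Real.inv_rpow hc.le, ← Real.rpow_neg hc.le, neg_mul, neg_neg] at key
    -- key : S n x = c ^ (n * Δ) * S n (c • x)
    have hcp : (0 : ℝ) < c ^ ((n : ℝ) * Δ) := Real.rpow_pos_of_pos hc _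
    rw [key, ← mul_assoc, neg_mul, Real.rpow_neg hc.le, inv_mul_cancel₀ hcp.ne', one_mul]
  · subst heq
    simp
  · exact scale_of_one_lt htr hinv hgt n x

end Summit.CriticalPhenomena.Ising3DConformalLimit.PrecisionLaplacianMoebiusLimitOfTwoPointLaw

end
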